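import Mathlib
import HarnessLib
import Summits.NavierStokesRegularity.NavierStokesRegularity.Theorems.CompletionRelayChainRelayFrontStepWakeShell
import Summits.NavierStokesRegularity.NavierStokesRegularity.Theorems.CompletionRelayChainRelayFrontStepTailProfile
import Summits.NavierStokesRegularity.NavierStokesRegularity.Theorems.TaoLadderRungThreeGappedFrontRobustTailEnergy

/-!
# `CompletionRelayChain` — crux `RelayFrontStep` (item stmt-NavierStokesRegularity-24850):
  A PRIORI ENERGY BOUND FOR THE BLOCK AND THE TAIL (helper for LINE `window_v2`, reshape v4 of `stub_frontCert`)

Along any `(η,η)`-pseudo-flow of a table in `E₂(64)` with the completion-relay rows, started in the repaired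
window `W₃` (wake clause on shell energies), the energy of EVERY shell `k ≥ −3` stays `≤ 5/2` and old shell
`−4` stays under `(1 + s/20)·wakeS (−4)` on the whole clock window `[0, 8]` — unconditionally
(`block_apriori`). Mechanism: the energy above the bond `−4 | −3` is fed only through that bond (tree
`GappedFrontRobust.pseudoFlowOn_shell_energy_le_tail`), the bond flux is the RELAY FLUX of shell `−4`
(`RelayFrontStep.abs_botSum_relay_le`: `≤ Λ₋₄ (u₋₄² + |r₋₄u₋₄|/32)·max(|x₋₃|,|u₋₃|)`, `Λ₋₄ = 2^{−10}`), the far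
wake keeps shell `−4` under `(1+s/20)·2` as long as shell `−3` stays under the epoch envelope
(`wake_shell_family_bound`), and a one-member bootstrap on the shell energy of old shell `−3` closes the loop
(flux `≤ 0.014`, start `Σ ≤ 47/20`, `47/20 + 8·0.014 < 5/2`). The start bound `∀ L, Σ_{k<L} Σᵢ F₀ i (−3+k) ≤ 47/20`
from a `W₃`-start with admissible slack is `block_start_le`.

Consequence for the line: the wake forcing hypothesis (W) of the front-block certificate becomes UNCONDITIONAL
and the certificate receives a global coarse enclosure `|S i k| ≤ √5` on old shells `k ≥ −3` for free
(skeleton `Cruxes/RelayFrontStep/Lines/window_v2.lean`, v4).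

No definitions. HONEST FRAMING: MODEL lattice only (Tao 2016 §4 vocabulary); helper for an open crux; nothing
here is a statement about the Navier–Stokes equations.
-/

noncomputable section

-- the summit-side namespace `Summit.NavierStokesRegularity.NavierStokesRegularity.…` (single-conjunct summit,
-- D-0017) repeats a component by design; the dupNamespace linter would flag every declaration.
set_option linter.dupNamespace false

open Set MeasureTheory intervalIntegral Literature.Analysis.FluidPDE Literature.Analysis.FluidPDE.TaoCascade
open Summit.NavierStokesRegularity.NavierStokesRegularity.Theorems
open Summit.NavierStokesRegularity.NavierStokesRegularity.Theorems.RelayFrontStep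
open Summit.NavierStokesRegularity.NavierStokesRegularity.Theorems.GappedFrontRobust

namespace Summit.NavierStokesRegularity.NavierStokesRegularity.Cruxes.RelayFrontStep.Window2

variable {τ κ₁ κ₂ : ℝ} {α : Fin 4 → Fin 4 → Fin 4 → ℤ × ℤ × ℤ → ℝ}
  {S₀ F₀ B₀ : Fin 4 → ℤ → ℝ} {S F : Fin 4 → ℤ → ℝ → ℝ}

/-! ### The start energies above the bond `−4 | −3` -/

/-- A sum over `range L` of a nonnegative sequence is at most (the first five terms) + (a uniform bound on the
partial sums of the rest). [folklore] -/
theorem sum_range_le_of_five {f : ℕ → ℝ} {A ε : ℝ} (hnn : ∀ k, 0 ≤ f k)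
    (hhead : ∑ k ∈ Finset.range 5, f k ≤ A) (htail : ∀ L' : ℕ, ∑ j ∈ Finset.range L', f (5 + j) ≤ ε)
    (hε : 0 ≤ ε) (L : ℕ) : ∑ k ∈ Finset.range L, f k ≤ A + ε := by
  by_cases hL : L ≤ 5
  · exact (Finset.sum_le_sum_of_subset_of_nonneg (Finset.range_mono hL) fun k _ _ => hnn k).trans
      (by linarith)
  · obtain ⟨n, rfl⟩ : ∃ n, L = 5 + n := ⟨L - 5, by omega⟩
    rw [Finset.sum_range_add]
    linarith [htail n]

/-- **Start energies of a `W₃`-start above the bond `−4 | −3`**: every partial sum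
`Σ_{k<L} Σᵢ F₀ i (−3+k)` is at most `47/20` (wake shells `−3, −2, −1`: `1 + 1/2 + 1/4`; front shell
`≤ ½(1 + ρ² + r₀²) + slack ≤ 0.5872`; next shell `≤ 0.012`; shells `≥ 2`: `≤ 2(3·aheadE 2 + idleE 2)`), given the
admissible slack `B₀ i 0 ≤ 3.5e-6`, `B₀ i 1 ≤ 1.8e-6` (the start energies of the two amplitude shells are
`≤ ½S₀² + B₀` by (4.10) at time `0`). -/
theorem block_start_le (h : PseudoFlowOn τ 1 α κ₁ κ₂ S₀ F₀ B₀ S F) (hτ : 0 < τ) (hW : RelayWindow₃ S₀ F₀)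
    (hB0 : ∀ i, B₀ i 0 ≤ 35 / 10 ^ 7) (hB1 : ∀ i, B₀ i 1 ≤ 18 / 10 ^ 7) :
    ∀ L : ℕ, ∑ k ∈ Finset.range L, ∑ i, F₀ i (-3 + k) ≤ 47 / 20 := by
  obtain ⟨h00, h10, h20l, h20u, h01l, h01u, h11l, h11u, h21l, h21u, hahead, hwake, hidle⟩ := hW
  have h0mem : (0 : ℝ) ∈ Icc 0 τ := ⟨le_rfl, hτ.le⟩
  -- nonnegativity of the start energies
  have hF0nn : ∀ i k, 0 ≤ F₀ i k := fun i k => by rw [← h.init_F i k]; exact h.nonneg_F i k 0 h0mem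
  -- start energies of the amplitude shells from (4.10) at time 0
  have hup : ∀ i k, F₀ i k ≤ (1 / 2) * S₀ i k ^ 2 + B₀ i k := by
    intro i k
    have := h.defect_upper i k 0 h0mem
    rw [intervalIntegral.integral_same, mul_zero, add_zero, h.init_F, h.init_S] at this
    exact this
  have hwS : ∀ k : ℤ, wakeS k = (1 / 8) * (2 : ℝ) ^ (-(k : ℝ)) := fun k => by unfold wakeS; ring
  have hf0 : ∑ i, F₀ i (-3) ≤ 1 := by
    refine (hwake (-3) (by norm_num)).trans ?_
    rw [hwS, show (-(((-3 : ℤ)) : ℝ)) = ((3 : ℕ) : ℝ) by push_cast; ring, Real.rpow_natCast]; norm_num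
  have hf1 : ∑ i, F₀ i (-2) ≤ 1 / 2 := by
    refine (hwake (-2) (by norm_num)).trans ?_
    rw [hwS, show (-(((-2 : ℤ)) : ℝ)) = ((2 : ℕ) : ℝ) by push_cast; ring, Real.rpow_natCast]; norm_num
  have hf2 : ∑ i, F₀ i (-1) ≤ 1 / 4 := by
    refine (hwake (-1) (by norm_num)).trans ?_
    rw [hwS, show (-(((-1 : ℤ)) : ℝ)) = ((1 : ℕ) : ℝ) by push_cast; ring, Real.rpow_natCast]; norm_num
  have hidle0 : F₀ 3 0 ≤ 1 / 10 ^ 10 := by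
    refine (hidle 0).trans ?_
    unfold idleE; rw [if_pos (by norm_num)]; norm_num
  have hidle1 : F₀ 3 1 ≤ 1 / 10 ^ 10 := by
    refine (hidle 1).trans ?_
    unfold idleE; rw [if_pos (by norm_num)]
    rw [show (-(((1 : ℤ)) : ℝ)) = -((1 : ℕ) : ℝ) by push_cast; ring, Real.rpow_neg (by norm_num),
      Real.rpow_natCast]; norm_num
  have hf3 : ∑ i, F₀ i 0 ≤ 5872 / 10000 := by
    rw [Fin.sum_univ_four]
    have e0 := hup 0 0; have e1 := hup 1 0; have e2 := hup 2 0
    rw [h00] at e0; rw [h10] at e1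
    have hb0 := hB0 0; have hb1 := hB0 1; have hb2 := hB0 2
    have hr : S₀ 2 0 ^ 2 ≤ (12 / 10000) ^ 2 := by nlinarith
    nlinarith
  have hf4 : ∑ i, F₀ i 1 ≤ 12 / 1000 := by
    rw [Fin.sum_univ_four]
    have e0 := hup 0 1; have e1 := hup 1 1; have e2 := hup 2 1
    have hb0 := hB1 0; have hb1 := hB1 1; have hb2 := hB1 2
    have hx : S₀ 0 1 ^ 2 ≤ (15 / 100) ^ 2 := by nlinarith
    have hu : S₀ 1 1 ^ 2 ≤ (1 / 100000) ^ 2 := by nlinarith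
    have hr : S₀ 2 1 ^ 2 ≤ (1 / 100000) ^ 2 := by nlinarith
    nlinarith
  -- the first five shells
  have hhead : ∑ k ∈ Finset.range 5, ∑ i, F₀ i (-3 + (k : ℤ)) ≤ 23492 / 10000 := by
    simp only [Finset.sum_range_succ, Finset.sum_range_zero, zero_add]
    norm_num
    linarith
  -- shells ≥ 2: the tail start bound
  have htail : ∀ L' : ℕ, ∑ j ∈ Finset.range L', ∑ i, F₀ i (-3 + ((5 + j : ℕ) : ℤ)) ≤ 1 / 10 ^ 9 := by
    intro L'
    have h1 := tail_start_le hahead hidle (K := 2) (by norm_num) L'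
    have h2 : ∑ j ∈ Finset.range L', ∑ i, F₀ i (-3 + ((5 + j : ℕ) : ℤ)) =
        ∑ j ∈ Finset.range L', ∑ i, F₀ i (2 + j) := by
      refine Finset.sum_congr rfl fun j _ => ?_
      congr 1; ext i; congr 1; push_cast; ring
    rw [h2]
    refine h1.trans ?_
    rw [est_eq (by norm_num)]
    have : (2 : ℝ) ^ (-(12 : ℝ) * (((2 : ℤ) : ℝ) - 1)) = 1 / 2 ^ 12 := by
      rw [show -(12 : ℝ) * (((2 : ℤ) : ℝ) - 1) = -((12 : ℕ) : ℝ) by push_cast; norm_num,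
        Real.rpow_neg (by norm_num), Real.rpow_natCast]; norm_num
    rw [this]; norm_num
  intro L
  have := sum_range_le_of_five (f := fun k : ℕ => ∑ i, F₀ i (-3 + (k : ℤ)))
    (fun k => Finset.sum_nonneg fun i _ => hF0nn i _) hhead htail (by norm_num) L
  linarith

/-! ### The flux through the bond `−4 | −3` -/

/-- `Λ₋₄ = 2^{−10}`. -/
theorem clock_neg_four : (1 + 1 : ℝ) ^ ((5 : ℝ) * (((-4 : ℤ)) : ℝ) / 2) = 1 / 2 ^ 10 := by
  rw [show (5 : ℝ) * (((-4 : ℤ)) : ℝ) / 2 = -((10 : ℕ) : ℝ) by push_cast; norm_num,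
    Real.rpow_neg (by norm_num), Real.rpow_natCast]
  norm_num

/-- **The flux into the block is small**: if old shell `−4` carries shell energy `≤ 14/5` and old shell `−3`
carries `≤ 3` per active mode at time `s`, then `|botSum(−4)(s)| ≤ 14/1000`. -/
theorem abs_botSum_neg_four_le (h : PseudoFlowOn τ 1 α κ₁ κ₂ S₀ F₀ B₀ S F) (hα : IsCancellingCoeff α)
    (hrows : RelayRows α) {s : ℝ} (hs : s ∈ Icc 0 τ) (hE4 : ∑ i, F i (-4) s ≤ 14 / 5)
    (hE3 : ∀ i : Fin 4, i ≠ 3 → F i (-3) s ≤ 3) :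
    |botSum 1 α S (-4) s| ≤ 14 / 1000 := by
  -- amplitudes of shell −3 (modes 0, 1) from their energies
  have hQ : ∀ i : Fin 4, i ≠ 3 → |S i (-4 + 1) s| ≤ 5 / 2 := by
    intro i hi
    rw [show (-4 + 1 : ℤ) = -3 by norm_num]
    refine abs_le_of_sq_le_sq ?_ (by norm_num)
    have := h.defect_lower i (-3) s hs
    have := hE3 i hi
    nlinarith
  have hb := abs_botSum_relay_le hα hrows S (-4) s (hQ 0 (by decide)) (hQ 1 (by decide))
  rw [clock_neg_four] at hb
  -- u₋₄² ≤ 2F_u, |r₋₄ u₋₄| ≤ F_r + F_u, both ≤ the shell energy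
  have hFu : F 1 (-4) s ≤ ∑ i, F i (-4) s :=
    Finset.single_le_sum (f := fun j => F j (-4) s) (fun j _ => h.nonneg_F j (-4) s hs) (Finset.mem_univ 1)
  have hFru : F 2 (-4) s + F 1 (-4) s ≤ ∑ i, F i (-4) s := by
    rw [Fin.sum_univ_four]
    linarith [h.nonneg_F 0 (-4) s hs, h.nonneg_F 3 (-4) s hs]
  have hu2 : S 1 (-4) s ^ 2 ≤ 2 * F 1 (-4) s := by linarith [h.defect_lower 1 (-4) s hs]
  have hr2 : S 2 (-4) s ^ 2 ≤ 2 * F 2 (-4) s := by linarith [h.defect_lower 2 (-4) s hs]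
  have hru : |S 2 (-4) s * S 1 (-4) s| ≤ F 2 (-4) s + F 1 (-4) s := by
    rw [abs_mul]
    nlinarith [abs_nonneg (S 2 (-4) s), abs_nonneg (S 1 (-4) s), sq_abs (S 2 (-4) s), sq_abs (S 1 (-4) s),
      sq_nonneg (|S 2 (-4) s| - |S 1 (-4) s|)]
  have hw : S 1 (-4) s ^ 2 + |S 2 (-4) s * S 1 (-4) s| / 32 ≤ 2 * (14 / 5) + (14 / 5) / 32 := by
    have h1 : |S 2 (-4) s * S 1 (-4) s| / 32 ≤ (14 / 5) / 32 :=
      div_le_div_of_nonneg_right (hru.trans (hFru.trans hE4)) (by norm_num)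
    linarith
  have hw0 : 0 ≤ S 1 (-4) s ^ 2 + |S 2 (-4) s * S 1 (-4) s| / 32 := by positivity
  calc |botSum 1 α S (-4) s| ≤ 1 / 2 ^ 10 * (S 1 (-4) s ^ 2 + |S 2 (-4) s * S 1 (-4) s| / 32) * (5 / 2) := hb
    _ ≤ 1 / 2 ^ 10 * (2 * (14 / 5) + (14 / 5) / 32) * (5 / 2) := by gcongr
    _ ≤ 14 / 1000 := by norm_num

/-! ### The a priori bound -/

/-- **A PRIORI ENERGY BOUND FOR THE BLOCK AND THE TAIL.** Along any `(η,η)`-pseudo-flow on `[0, τ]`, `τ ≥ 8`,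
of a table in `E₂(64)` with the completion-relay rows, with start energies above the bond `−4 | −3` of total
`≤ 47/20` (`block_start_le`) and the shell-energy wake clauses `Σᵢ F₀ i k ≤ wakeS k` (`k ≤ −1`): for all
`s ∈ [0, 8]`, (i) old shell `−4` keeps `Σᵢ F i (−4) s ≤ (1 + s/20)·wakeS (−4)` and (ii) EVERY shell `k ≥ −3`
keeps `Σᵢ F i k s ≤ 5/2`. [cite: Tao2016AveragedNS, §4 Lemma 4.1 (4.5), (4.9), (4.10) with (4.3)] -/
theorem block_apriori (h : PseudoFlowOn τ 1 α κ₁ κ₂ S₀ F₀ B₀ S F) (hτ8 : 8 ≤ τ) (hE : InTableClass 64 α)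
    (hrows : RelayRows α) (hE0 : ∀ L : ℕ, ∑ k ∈ Finset.range L, ∑ i, F₀ i (-3 + k) ≤ 47 / 20)
    (hwake : ∀ k : ℤ, k ≤ -1 → ∑ i, F₀ i k ≤ wakeS k) :
    (∀ s ∈ Icc (0 : ℝ) τ, s ≤ 8 → ∑ i, F i (-4) s ≤ (1 + s / 20) * wakeS (-4)) ∧
    (∀ s ∈ Icc (0 : ℝ) τ, s ≤ 8 → ∀ k : ℤ, -3 ≤ k → ∑ i, F i k s ≤ 5 / 2) := by
  have hτ : 0 < τ := by linarith
  have hα : IsCancellingCoeff α := hE.2.1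
  have h8 : (8 : ℝ) ∈ Icc 0 τ := ⟨by norm_num, hτ8⟩
  have hS : ∀ i n, ContinuousOn (S i n) (Icc 0 τ) := fun i n => (h.contDiffOn_S i n).continuousOn
  have hwake' : ∀ k : ℤ, k ≤ -1 → ∑ i, F₀ i k ≤ (1 / 8) * (2 : ℝ) ^ (-(k : ℝ)) := by
    intro k hk; have := hwake k hk; unfold wakeS at this; linarith
  have hwS4 : wakeS (-4) = 2 := by
    unfold wakeS
    rw [show (-(((-4 : ℤ)) : ℝ)) = ((4 : ℕ) : ℝ) by push_cast; ring, Real.rpow_natCast]; norm_num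
  -- (W) from the far wake: shell −3 under 16 on [0,t] ⇒ shell −4 under (1+s/20)·2 on [0,t]
  have hW : ∀ t ∈ Icc (0 : ℝ) τ, t ≤ 8 →
      (∀ s ∈ Icc (0 : ℝ) t, ∀ i : Fin 4, i ≠ 3 → F i (-3) s ≤ relayEnv₂ (-3)) →
        ∀ s ∈ Icc (0 : ℝ) t, ∑ i, F i (-4) s ≤ (1 + s / 20) * 2 := by
    intro t ht ht8 h3 s hs
    have := wake_shell_family_bound h hτ hrows hwake' ht ht8 h3 (-4) le_rfl s hs
    rw [show (-(((-4 : ℤ)) : ℝ)) = ((4 : ℕ) : ℝ) by push_cast; ring, Real.rpow_natCast] at this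
    linarith
  -- the tail/block energy fed through the bond −4 | −3
  have htail : ∀ (k : ℤ), -3 ≤ k → ∀ s ∈ Icc (0 : ℝ) τ,
      ∑ i, F i k s ≤ 47 / 20 + ∫ u in (0 : ℝ)..s, botSum 1 α S (-4) u := by
    intro k hk s hs
    have := pseudoFlowOn_shell_energy_le_tail h hτ one_pos hα (-3) hE0 hk hs
    rwa [show (-3 - 1 : ℤ) = -4 by norm_num] at this
  -- integrating a flux bound
  have hint : ∀ t ∈ Icc (0 : ℝ) τ, (∀ u ∈ Icc (0 : ℝ) t, |botSum 1 α S (-4) u| ≤ 14 / 1000) →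
      (∫ u in (0 : ℝ)..t, botSum 1 α S (-4) u) ≤ 14 / 1000 * t := by
    intro t ht hb
    have hsub : uIcc 0 t ⊆ Icc 0 τ := by rw [uIcc_of_le ht.1]; exact Icc_subset_Icc_right ht.2
    have hi : IntervalIntegrable (fun u => botSum 1 α S (-4) u) volume 0 t :=
      ((continuousOn_botSum 1 α hS (-4)).mono hsub).intervalIntegrable
    have h1 : (∫ u in (0 : ℝ)..t, botSum 1 α S (-4) u) ≤ ∫ u in (0 : ℝ)..t, (14 / 1000 : ℝ) :=
      intervalIntegral.integral_mono_on ht.1 hi (by simp) fun u hu => (le_abs_self _).trans (hb u hu)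
    rw [intervalIntegral.integral_const, smul_eq_mul] at h1
    linarith
  -- STEP 1: bootstrap on the shell energy of old shell −3 over [0, 8]
  obtain ⟨M, hM0, hM⟩ := wake_apriori_abs h
  have key := bootstrap_family_oneSided_slack (ι := Unit) (u := fun _ t => ∑ i, F i (-3) t)
    (p := fun _ => (1 : ℝ)) (ψ := fun _ => (5 / 2 : ℝ)) (τ := 8) (L := 3 * M ^ 3) (θ := 6 / 5)
    (by norm_num) (fun _ => zero_le_one) (by positivity) continuousOn_const (fun _ _ => by norm_num)
    ?hgrow ?h0 ?himp
  case hgrow =>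
    intro _ s hs t ht hst
    have htτ : t ≤ τ := ht.2.trans hτ8
    have := pseudoFlowOn_shell_increment_le_const h hτ (-3) hs.1 hst htτ fun u hu =>
      wake_shell_crude_rate hrows hM (by norm_num) ⟨hs.1.trans hu.1, hu.2.trans htτ⟩
    linarith
  case h0 =>
    intro _
    have h1 : ∑ i, F i (-3) 0 = ∑ i, F₀ i (-3) := Finset.sum_congr rfl fun i _ => h.init_F i (-3)
    have h2 := hwake' (-3) (by norm_num)
    rw [show (-(((-3 : ℤ)) : ℝ)) = ((3 : ℕ) : ℝ) by push_cast; ring, Real.rpow_natCast] at h2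
    rw [h1]; linarith
  case himp =>
    intro t ht hweak _
    have htτ : t ∈ Icc (0 : ℝ) τ := ⟨ht.1, ht.2.trans hτ8⟩
    -- shell −3 per mode ≤ 3 ≤ 16 on [0,t]
    have hE3 : ∀ s ∈ Icc (0 : ℝ) t, ∀ i : Fin 4, i ≠ 3 → F i (-3) s ≤ 3 := by
      intro s hs i _
      have h1 : F i (-3) s ≤ ∑ j, F j (-3) s :=
        Finset.single_le_sum (f := fun j => F j (-3) s)
          (fun j _ => h.nonneg_F j (-3) s ⟨hs.1, hs.2.trans htτ.2⟩) (Finset.mem_univ i)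
      have h2 : ∑ j, F j (-3) s ≤ 6 / 5 * (5 / 2) * 1 := hweak () s hs
      linarith
    have h3 : ∀ s ∈ Icc (0 : ℝ) t, ∀ i : Fin 4, i ≠ 3 → F i (-3) s ≤ relayEnv₂ (-3) := by
      intro s hs i hi; rw [relayEnv₂_neg_three]; linarith [hE3 s hs i hi]
    have hE4 : ∀ s ∈ Icc (0 : ℝ) t, ∑ i, F i (-4) s ≤ 14 / 5 := by
      intro s hs
      have := hW t htτ ht.2 h3 s hs
      have hs8 : s ≤ 8 := hs.2.trans ht.2
      linarith
    have hb : ∀ u ∈ Icc (0 : ℝ) t, |botSum 1 α S (-4) u| ≤ 14 / 1000 := fun u hu =>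
      abs_botSum_neg_four_le h hα hrows ⟨hu.1, hu.2.trans htτ.2⟩ (hE4 u hu) (hE3 u hu)
    have h1 := htail (-3) le_rfl t htτ
    have h2 := hint t htτ hb
    have ht8 := ht.2
    show ∑ i, F i (-3) t ≤ 5 / 2 * 1
    linarith
  -- STEP 2: consequences on [0, 8]
  have hE3all : ∀ s ∈ Icc (0 : ℝ) τ, s ≤ 8 → ∀ i : Fin 4, i ≠ 3 → F i (-3) s ≤ relayEnv₂ (-3) := by
    intro s hs hs8 i _
    have h1 : F i (-3) s ≤ ∑ j, F j (-3) s :=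
      Finset.single_le_sum (f := fun j => F j (-3) s) (fun j _ => h.nonneg_F j (-3) s hs) (Finset.mem_univ i)
    have h2 : ∑ j, F j (-3) s ≤ 5 / 2 * 1 := key () s ⟨hs.1, hs8⟩
    rw [relayEnv₂_neg_three]; linarith
  have hW8 : ∀ s ∈ Icc (0 : ℝ) τ, s ≤ 8 → ∑ i, F i (-4) s ≤ (1 + s / 20) * 2 := fun s hs hs8 =>
    hW 8 h8 le_rfl (fun u hu i hi => hE3all u ⟨hu.1, hu.2.trans hτ8⟩ hu.2 i hi) s ⟨hs.1, hs8⟩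
  refine ⟨fun s hs hs8 => by rw [hwS4]; exact hW8 s hs hs8, fun s hs hs8 k hk => ?_⟩
  have hb : ∀ u ∈ Icc (0 : ℝ) s, |botSum 1 α S (-4) u| ≤ 14 / 1000 := by
    intro u hu
    have huτ : u ∈ Icc (0 : ℝ) τ := ⟨hu.1, hu.2.trans hs.2⟩
    have hu8 : u ≤ 8 := hu.2.trans hs8
    refine abs_botSum_neg_four_le h hα hrows huτ ?_ ?_
    · have := hW8 u huτ hu8; linarith
    · intro i hi; have := hE3all u huτ hu8 i hi; rw [relayEnv₂_neg_three] at this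
      have h1 : F i (-3) u ≤ ∑ j, F j (-3) u :=
        Finset.single_le_sum (f := fun j => F j (-3) u) (fun j _ => h.nonneg_F j (-3) u huτ)
          (Finset.mem_univ i)
      have h2 : ∑ j, F j (-3) u ≤ 5 / 2 * 1 := key () u ⟨hu.1, hu8⟩
      linarith
  have h1 := htail k hk s hs
  have h2 := hint s hs hb
  linarith

end Summit.NavierStokesRegularity.NavierStokesRegularity.Cruxes.RelayFrontStep.Window2
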